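import Literature.AlgebraicGeometry.ModuliOfAbelianVarieties.SiegelAdmissibleMarkingUniqueTorus
import Literature.Geometry.Kaehler.ComplexTorusLift
import HarnessLib

/-!
# MRK-READ: readings through THE admissible marking are independent of the period point — an integral endomorphism `A` commuting with
# the transition `M ∈ Γ_δ(N)` reads the same through the markings at `Z` and at `M • Z`
# ([Milne2005ShimuraVarieties] Thm. 6.11 + Lemma 5.13; [Lange2023AbelianVarietiesComplex] Prop. 3.1.4, Rem. 3.1.10; [Shimura1963AnalyticFamilies] §2)

Topic `Literature/AlgebraicGeometry/ModuliOfAbelianVarieties`; namespace `Literature.AlgebraicGeometry.ModuliOfAbelianVarieties.SiegelAdelicMarking`.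
THEOREMS ONLY (no definition, no named fact, no instance, no notation, no `sorry`).  Sequel of ★ `SiegelAdmissibleMarkingUniqueTorus` (MRK-TRANSPORT,
A-p15).  Cell `hodgecm-mathlib` (D-0151), FLOOR 0, P6 «MOD» (crux hLiu418 = stmt-HodgeConjecture-24832, `--supports`), organ **MRK-READ** of the E6
closer of `Cruxes/HLiu418/Lines/F0_P6a_PELWitnessE.lean` (socket Σ-AN `ReadsCReading`, E6 heir A-p06 (g33)): it is the `hcompat` input of ★ E6-an′
`AbelianSchemeOver.exists_isMonHom_of_chartReadings` — the local holomorphic endomorphisms built over two lift domains from the lattice reading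
`A = Mρ a b` AGREE on the common fibres, because the two ★ P-3 chart markings are admissible for the same `r` at period points `Z`, `Z′ = M • Z`
with `M` commuting with `Mρ a b` (`AuxChartGS.Z_equivariant`).  HC_CM is proved only modulo the printed citations (2 remaining named inputs hLiu418
24832, h413 24833) until rung 0 closes; this file is generic and changes no count.

THE MATHEMATICS.  Two admissibility data `(m, Θ, Λ)` at `Z` and `(m′, Θ′, Λ′)` at `Z′ = gDHom M • Z` (`M ∈ Γ_δ(N)`, `N ≥ 3`, unit frames
`γ = γ′ = 1`) of ONE fibre triple have torus maps related by ★ MRK-TRANSPORT: `toFun′ (π (M x)) = toFun (π x)` on `ℝ^{2g}`.  Let `A ∈ M_{2g}(ℤ)`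
commute with `M`.  If two real vectors mark the same point, `toFun (π x) = toFun′ (π x′)`, then `π x′ = π (M x)` (the torus map of an analytification
is injective), i.e. `x′ = M x + n` with `n ∈ ℤ^{2g}`, and therefore `toFun (π (A x)) = toFun′ (π (M A x)) = toFun′ (π (A M x)) = toFun′ (π (A x′ − A n))
= toFun′ (π (A x′))`: THE READING OF `A` IS THE SAME THROUGH BOTH MARKINGS (§1).  §2 is the same in the complex coordinates of the markings
(`cover Ψ`, with `ℂ`-side avatars `C (Ψ x) = Ψ (A x)`, `C′ (Ψ′ x) = Ψ′ (A x)` — the shape of ★ `AuxChartGS.Mρ_kottwitz` and of the relative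
exponential charts of ★ E6-an′).  This is [Shimura1963AnalyticFamilies] §2 (an endomorphism of the period lattice commuting with the monodromy defines
an endomorphism of the family) at one fibre, on top of [Milne2005ShimuraVarieties] Thm. 6.11 (rigidity of admissible markings at level `N ≥ 3`).

* §1 **`toFun_proj_mulVec_eq_of_toFun_proj_eq`** — proj form on `ℝ^{2g}`.
* §2 **`toFun_cover_apply_eq_of_toFun_cover_eq`** — cover ∕ avatar form on `ℂ^g` (THE HEAD for E6-an′'s `hcompat`).
* §3 (ED. 2) **`toFun_cover_apply_eq_of_periodRel`** — the same with the mover SUPPLIED AS A PERIOD RELATION `L ∘ Π_Z = Π_{Z′} ∘ M₀`, `M₀ ∈ Γ_δ(N)`,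
  `M₀ A = A M₀` (the exact shape of ★ `AuxChartGS.Z_equivariant`): ★ `SiegelModuli.rel_iff_exists_smul` for the subgroup `Γ_δ(N) ∩ C(A)` turns it
  into a mover `M ∈ Γ_δ(N)` commuting with `A` with `Z′ = gDHom M • Z`, and §2 applies — no separate uniqueness-of-the-mover step is needed.

## References
* [Milne2005ShimuraVarieties] J. S. Milne, *Introduction to Shimura Varieties* (2005; rev. 2017), §6 Thm. 6.11 pp. 74–75, Lemma 5.13 p. 57.
* [Lange2023AbelianVarietiesComplex] H. Lange, *Abelian Varieties over the Complex Numbers* (2023), §3.1.2 Prop. 3.1.4, §3.1.3 Remark 3.1.10 (2).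
* [Shimura1963AnalyticFamilies] G. Shimura, *On analytic families of polarized abelian varieties and automorphic functions*, Ann. Math. 78 (1963), §2.
-/

set_option autoImplicit false

noncomputable section

open Matrix CategoryTheory AlgebraicGeometry Topology
open Literature.AlgebraicGeometry.Motives (AbelianVariety AlgPoints CartierDivisor)
open Literature.AlgebraicGeometry.AbelianSchemes (AbelianSchemeOver)
open Literature.NumberTheory.Automorphic (siegelUpperHalfSpace)
open Literature.Geometry.Kaehler (ComplexTorus)
open Literature.Geometry.Kaehler.ComplexTorus (proj cover)

namespace Literature.AlgebraicGeometry.ModuliOfAbelianVarieties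

open SiegelModuli

variable {g : ℕ} {δ : Fin g → ℕ} {N : ℕ} {S : Scheme} {B : AbelianSchemeOver S} {s : Spec (CommRingCat.of ℂ) ⟶ S} {D : B.DualPair}
  {lam : B.X ⟶ D.hat.X} {φ : B.LevelStructure g N} {Θ Θ' : CartierDivisor (B.fibre s).toAbelianVariety.X.left}
  {r : gspFinAdelic δ} {Z Z' : Matrix (Fin g) (Fin g) ℂ}

/-- `A_ℝ (n) ∈ ℤ^{2g}` for integral `A` and `n ∈ ℤ^{2g}`: `A_ℝ *ᵥ (n : ℝ^{2g}) = ((A *ᵥ n) : ℝ^{2g})` (plumbing). [folklore] -/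
private theorem map_intCast_mulVec_intCast (A : Matrix (Fin g ⊕ Fin g) (Fin g ⊕ Fin g) ℤ) (n : Fin g ⊕ Fin g → ℤ) :
    (A.map (Int.cast : ℤ → ℝ)) *ᵥ (fun i => (n i : ℝ)) = fun i => ((A *ᵥ n) i : ℝ) := by
  funext i
  simp only [Matrix.mulVec, dotProduct, Matrix.map_apply, Int.cast_sum, Int.cast_mul]

/-- An integer vector projects to `0` in `(ℝ∕ℤ)^{2g}` (local copy of the one-liner of ★ `ComplexTorusFibrationTorsionReadings`, to keep the imports
light). [folklore] -/
private theorem proj_intCast' {E : Type*} [NormedAddCommGroup E] [NormedSpace ℂ E] (Ψ : (Fin g ⊕ Fin g → ℝ) ≃L[ℝ] E)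
    (w : Fin g ⊕ Fin g → ℤ) : proj Ψ (fun i => (w i : ℝ)) = 0 := by
  funext i
  rw [ComplexTorus.proj_apply]
  change ((w i : ℝ) : AddCircle (1 : ℝ)) = 0
  rw [AddCircle.coe_eq_zero_iff]
  exact ⟨w i, by rw [zsmul_eq_mul, mul_one]⟩

/-- `M_ℝ (A_ℝ x) = A_ℝ (M_ℝ x)` when `M A = A M` over `ℤ` (plumbing). [folklore] -/
private theorem intAct_map_mulVec_comm {M : GL (Fin g ⊕ Fin g) ℤ} {A : Matrix (Fin g ⊕ Fin g) (Fin g ⊕ Fin g) ℤ}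
    (hMA : (M : Matrix (Fin g ⊕ Fin g) (Fin g ⊕ Fin g) ℤ) * A = A * M) (x : Fin g ⊕ Fin g → ℝ) :
    intAct M ((A.map (Int.cast : ℤ → ℝ)) *ᵥ x) = (A.map (Int.cast : ℤ → ℝ)) *ᵥ intAct M x := by
  have hmul : ∀ P Q : Matrix (Fin g ⊕ Fin g) (Fin g ⊕ Fin g) ℤ,
      (P * Q).map (Int.cast : ℤ → ℝ) = P.map (Int.cast : ℤ → ℝ) * Q.map (Int.cast : ℤ → ℝ) := fun P Q =>
    Matrix.map_mul (f := Int.castRingHom ℝ)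
  unfold intAct
  rw [Matrix.mulVec_mulVec, Matrix.mulVec_mulVec, ← hmul, ← hmul, hMA]

/-! ### §1 The reading of a commuting integral matrix is frame-independent (proj form) -/

/-- **MRK-READ on `ℝ^{2g}`.**  Two admissibility data of one fibre triple at `Z` and `Z′ = gDHom M • Z` (`M ∈ Γ_δ(N)`, `N ≥ 3`, unit frames) and an
integral `A` with `M A = A M`: if `toFun (π x) = toFun′ (π x′)` then `toFun (π (A_ℝ x)) = toFun′ (π (A_ℝ x′))` — the endomorphism read as `A` through
THE admissible marking does not depend on the period point at which the fibre is marked (★ MRK-TRANSPORT `toFun_proj_intAct_eq_of_lifts_of_smul_of_frame_eq_one`,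
injectivity of `toFun′`, `x′ ≡ M x (mod ℤ^{2g})`, `A M = M A`, `A ℤ^{2g} ⊆ ℤ^{2g}`).
[cite: Milne2005ShimuraVarieties, §6 Thm. 6.11 pp. 74–75; Lemma 5.13 p. 57] [cite: Lange2023AbelianVarietiesComplex, §3.1.2 Prop. 3.1.4; §3.1.3 Remark 3.1.10 (2)]
[cite: Shimura1963AnalyticFamilies, §2] -/
theorem SiegelAdelicMarking.toFun_proj_mulVec_eq_of_toFun_proj_eq (hg : 0 < g) (hδ : IsPolarizationType δ) (hN : 3 ≤ N)
    (hr : r ∈ principalLevelSubgroup δ 1) (hZ : Z ∈ siegelUpperHalfSpace g) (hZ' : Z' ∈ siegelUpperHalfSpace g)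
    (m : SiegelAdelicMarking ⟨jOfSiegel δ Z, SiegelComplexRecordSystem.jOfSiegel_mem_C0pm hδ.1 hZ⟩ r (B.fibre s).toAbelianVariety)
    (Λ : φ.SymplecticLift s Θ δ) (hΘl : B.IsLambdaOfAt s D lam Θ)
    (hΛ : ∀ ⦃M : ℕ⦄, N ∣ M → M ≠ 0 → ∀ (x : Fin g ⊕ Fin g → ZMod M) (v : Fin g ⊕ Fin g → ℚ),
      AdelicCongr ((r⁻¹ : gspFinAdelic δ) : GL (Fin g ⊕ Fin g) finAdeleQ) 1 v (fun i => ((x i).val : ℚ) / M) →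
        ((Λ.lift M (Multiplicative.ofAdd x)) : (B.fibre s).toAbelianVariety.Points ℂ) = m.r v)
    (m' : SiegelAdelicMarking ⟨jOfSiegel δ Z', SiegelComplexRecordSystem.jOfSiegel_mem_C0pm hδ.1 hZ'⟩ r (B.fibre s).toAbelianVariety)
    (Λ' : φ.SymplecticLift s Θ' δ) (hΘl' : B.IsLambdaOfAt s D lam Θ')
    (hΛ' : ∀ ⦃M : ℕ⦄, N ∣ M → M ≠ 0 → ∀ (x : Fin g ⊕ Fin g → ZMod M) (v : Fin g ⊕ Fin g → ℚ),
      AdelicCongr ((r⁻¹ : gspFinAdelic δ) : GL (Fin g ⊕ Fin g) finAdeleQ) 1 v (fun i => ((x i).val : ℚ) / M) →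
        ((Λ'.lift M (Multiplicative.ofAdd x)) : (B.fibre s).toAbelianVariety.Points ℂ) = m'.r v)
    (M : symplecticLatticeGroup δ) (hM : (M : GL (Fin g ⊕ Fin g) ℤ) ∈ siegelLevelGroup δ N)
    (hZZ' : (⟨Z', hZ'⟩ : siegelUpperHalfSpace g) = gDHom δ hδ.1 M • ⟨Z, hZ⟩) (hγ : m.γ = 1) (hγ' : m'.γ = 1)
    (A : Matrix (Fin g ⊕ Fin g) (Fin g ⊕ Fin g) ℤ)
    (hMA : (((M : GL (Fin g ⊕ Fin g) ℤ) : Matrix (Fin g ⊕ Fin g) (Fin g ⊕ Fin g) ℤ)) * A = A * ((M : GL (Fin g ⊕ Fin g) ℤ) : Matrix _ _ ℤ))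
    {x x' : Fin g ⊕ Fin g → ℝ} (h : m.toFun (proj m.Ψ x) = m'.toFun (proj m'.Ψ x')) :
    m.toFun (proj m.Ψ ((A.map (Int.cast : ℤ → ℝ)) *ᵥ x)) = m'.toFun (proj m'.Ψ ((A.map (Int.cast : ℤ → ℝ)) *ᵥ x')) := by
  -- ★ MRK-TRANSPORT: `toFun′ (π (M y)) = toFun (π y)` for every `y`
  have T := fun y => SiegelAdelicMarking.toFun_proj_intAct_eq_of_lifts_of_smul_of_frame_eq_one hg hδ hN hr hZ hZ' m Λ hΘl hΛ
    m' Λ' hΘl' hΛ' M hM hZZ' hγ hγ' y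
  -- `x′ ≡ M x (mod ℤ^{2g})`
  have h1 : m'.toFun (proj m'.Ψ x') = m'.toFun (proj m'.Ψ (intAct (M : GL (Fin g ⊕ Fin g) ℤ) x)) := by rw [← h, T x]
  have h2 : proj m'.Ψ x' = proj m'.Ψ (intAct (M : GL (Fin g ⊕ Fin g) ℤ) x) := m'.isAnalytification.isHomeomorph.injective h1
  obtain ⟨n, hn⟩ := (ComplexTorus.proj_eq_proj_iff (Φ' := m'.Ψ)).1 h2
  -- read `A` on both sides
  rw [← T ((A.map (Int.cast : ℤ → ℝ)) *ᵥ x), intAct_map_mulVec_comm hMA, hn, Matrix.mulVec_add, map_intCast_mulVec_intCast,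
    ComplexTorus.proj_add]
  rw [proj_intCast' m'.Ψ (A *ᵥ n), add_zero]

/-! ### §2 The head: cover ∕ avatar form on `ℂ^g` -/

/-- **MRK-READ (THE HEAD, complex coordinates).**  Same setting; `C, C′ : ℂ^g → ℂ^g` the avatars of `A` in the complex coordinates of the two markings
(`C (Ψ x) = Ψ (A_ℝ x)`, `C′ (Ψ′ x) = Ψ′ (A_ℝ x)` — the shape of ★ `AuxChartGS.Mρ_kottwitz`).  Then two complex vectors marking the same point,
`toFun (π z) = toFun′ (π z′)`, still do after `C`, `C′`: `toFun (π (C z)) = toFun′ (π (C′ z′))`.  This is EXACTLY the `hcompat` input of ★ E6-an′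
`AbelianSchemeOver.exists_isMonHom_of_chartReadings` for two ★ P-3 charts of the universal family whose period points differ by `M` (the (ADM) clause:
chart fibre map `=` torus map of THE admissible marking with `γ = 1`, `Ψ = Π_Z`).
[cite: Milne2005ShimuraVarieties, §6 Thm. 6.11 pp. 74–75] [cite: Lange2023AbelianVarietiesComplex, §3.1.2 Prop. 3.1.4] [cite: Shimura1963AnalyticFamilies, §2] -/
theorem SiegelAdelicMarking.toFun_cover_apply_eq_of_toFun_cover_eq (hg : 0 < g) (hδ : IsPolarizationType δ) (hN : 3 ≤ N)
    (hr : r ∈ principalLevelSubgroup δ 1) (hZ : Z ∈ siegelUpperHalfSpace g) (hZ' : Z' ∈ siegelUpperHalfSpace g)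
    (m : SiegelAdelicMarking ⟨jOfSiegel δ Z, SiegelComplexRecordSystem.jOfSiegel_mem_C0pm hδ.1 hZ⟩ r (B.fibre s).toAbelianVariety)
    (Λ : φ.SymplecticLift s Θ δ) (hΘl : B.IsLambdaOfAt s D lam Θ)
    (hΛ : ∀ ⦃M : ℕ⦄, N ∣ M → M ≠ 0 → ∀ (x : Fin g ⊕ Fin g → ZMod M) (v : Fin g ⊕ Fin g → ℚ),
      AdelicCongr ((r⁻¹ : gspFinAdelic δ) : GL (Fin g ⊕ Fin g) finAdeleQ) 1 v (fun i => ((x i).val : ℚ) / M) →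
        ((Λ.lift M (Multiplicative.ofAdd x)) : (B.fibre s).toAbelianVariety.Points ℂ) = m.r v)
    (m' : SiegelAdelicMarking ⟨jOfSiegel δ Z', SiegelComplexRecordSystem.jOfSiegel_mem_C0pm hδ.1 hZ'⟩ r (B.fibre s).toAbelianVariety)
    (Λ' : φ.SymplecticLift s Θ' δ) (hΘl' : B.IsLambdaOfAt s D lam Θ')
    (hΛ' : ∀ ⦃M : ℕ⦄, N ∣ M → M ≠ 0 → ∀ (x : Fin g ⊕ Fin g → ZMod M) (v : Fin g ⊕ Fin g → ℚ),
      AdelicCongr ((r⁻¹ : gspFinAdelic δ) : GL (Fin g ⊕ Fin g) finAdeleQ) 1 v (fun i => ((x i).val : ℚ) / M) →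
        ((Λ'.lift M (Multiplicative.ofAdd x)) : (B.fibre s).toAbelianVariety.Points ℂ) = m'.r v)
    (M : symplecticLatticeGroup δ) (hM : (M : GL (Fin g ⊕ Fin g) ℤ) ∈ siegelLevelGroup δ N)
    (hZZ' : (⟨Z', hZ'⟩ : siegelUpperHalfSpace g) = gDHom δ hδ.1 M • ⟨Z, hZ⟩) (hγ : m.γ = 1) (hγ' : m'.γ = 1)
    (A : Matrix (Fin g ⊕ Fin g) (Fin g ⊕ Fin g) ℤ)
    (hMA : (((M : GL (Fin g ⊕ Fin g) ℤ) : Matrix (Fin g ⊕ Fin g) (Fin g ⊕ Fin g) ℤ)) * A = A * ((M : GL (Fin g ⊕ Fin g) ℤ) : Matrix _ _ ℤ))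
    (C C' : (Fin g → ℂ) → (Fin g → ℂ)) (hC : ∀ x : Fin g ⊕ Fin g → ℝ, C (m.Ψ x) = m.Ψ ((A.map (Int.cast : ℤ → ℝ)) *ᵥ x))
    (hC' : ∀ x : Fin g ⊕ Fin g → ℝ, C' (m'.Ψ x) = m'.Ψ ((A.map (Int.cast : ℤ → ℝ)) *ᵥ x))
    {z z' : Fin g → ℂ} (h : m.toFun (cover m.Ψ z) = m'.toFun (cover m'.Ψ z')) :
    m.toFun (cover m.Ψ (C z)) = m'.toFun (cover m'.Ψ (C' z')) := by
  obtain ⟨x, rfl⟩ := m.Ψ.surjective z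
  obtain ⟨x', rfl⟩ := m'.Ψ.surjective z'
  rw [ComplexTorus.cover_apply_apply, ComplexTorus.cover_apply_apply] at h
  rw [hC, hC', ComplexTorus.cover_apply_apply, ComplexTorus.cover_apply_apply]
  exact SiegelAdelicMarking.toFun_proj_mulVec_eq_of_toFun_proj_eq hg hδ hN hr hZ hZ' m Λ hΘl hΛ m' Λ' hΘl' hΛ' M hM hZZ' hγ hγ' A hMA h

/-! ### §3 (ED. 2) The head with the mover supplied as a period relation (`AuxChartGS.Z_equivariant` shape) -/

/-- The integral matrices commuting with `A`, as a subgroup of `GL_{2g}(ℤ)` (the centraliser of `A` met with the units; proof-local plumbing made a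
lemma so that §3 can name it). [folklore] -/
private theorem exists_subgroup_comm (A : Matrix (Fin g ⊕ Fin g) (Fin g ⊕ Fin g) ℤ) :
    ∃ Γ : Subgroup (GL (Fin g ⊕ Fin g) ℤ), ∀ M : GL (Fin g ⊕ Fin g) ℤ,
      M ∈ Γ ↔ (M : Matrix (Fin g ⊕ Fin g) (Fin g ⊕ Fin g) ℤ) * A = A * M := by
  refine ⟨{ carrier := {M | (M : Matrix (Fin g ⊕ Fin g) (Fin g ⊕ Fin g) ℤ) * A = A * M}
            one_mem' := by simp
            mul_mem' := ?_
            inv_mem' := ?_ }, fun M => Iff.rfl⟩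
  · intro M M' hM hM'
    simp only [Set.mem_setOf_eq, Units.val_mul] at hM hM' ⊢
    rw [Matrix.mul_assoc, hM', ← Matrix.mul_assoc, hM, Matrix.mul_assoc]
  · intro M hM
    simp only [Set.mem_setOf_eq] at hM ⊢
    set Mi : Matrix (Fin g ⊕ Fin g) (Fin g ⊕ Fin g) ℤ := ((M⁻¹ : GL (Fin g ⊕ Fin g) ℤ) : Matrix (Fin g ⊕ Fin g) (Fin g ⊕ Fin g) ℤ)
      with hMi
    have hinv : Mi * (M : Matrix (Fin g ⊕ Fin g) (Fin g ⊕ Fin g) ℤ) = 1 := by rw [hMi]; exact Units.inv_mul M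
    have hinv' : (M : Matrix (Fin g ⊕ Fin g) (Fin g ⊕ Fin g) ℤ) * Mi = 1 := by rw [hMi]; exact Units.mul_inv M
    calc Mi * A = Mi * A * ((M : Matrix (Fin g ⊕ Fin g) (Fin g ⊕ Fin g) ℤ) * Mi) := by rw [hinv', Matrix.mul_one]
      _ = Mi * ((M : Matrix (Fin g ⊕ Fin g) (Fin g ⊕ Fin g) ℤ) * A) * Mi := by
          rw [hM]; simp only [Matrix.mul_assoc]
      _ = A * Mi := by rw [← Matrix.mul_assoc, hinv, Matrix.one_mul]

/-- **MRK-READ WITH THE MOVER AS A PERIOD RELATION (the `Z_equivariant` shape).**  Two admissibility data `(m, Θ, Λ)` at `Z`, `(m′, Θ′, Λ′)` at `Z′` (unit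
frames) of ONE fibre triple; an integral `A` with avatars `C`, `C′` in the complex coordinates of the two markings; and a PERIOD RELATION
`L ∘ Π_Z = Π_{Z′} ∘ M₀` for a `ℂ`-linear automorphism `L` and some `M₀ ∈ Γ_δ(N)` COMMUTING WITH `A` (exactly what ★ `AuxChartGS.Z_equivariant` delivers for
the lattice reading `A = Mρ a b` at two lifts of one point of the record curve).  Then `toFun (π z) = toFun′ (π z′) → toFun (π (C z)) = toFun′ (π (C′ z′))`
— the `hcompat` input of ★ E6-an′ for the two ★ P-3 charts.  Proof: ★ `SiegelModuli.rel_iff_exists_smul` for the subgroup `Γ_δ(N) ∩ C(A) ≤ Sp_δ(ℤ)` gives a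
mover `M ∈ Γ_δ(N)` with `M A = A M` and `Z′ = gDHom M • Z`; then §2.
[cite: Milne2005ShimuraVarieties, §6 Thm. 6.11 pp. 74–75] [cite: Lange2023AbelianVarietiesComplex, §3.1.2 Prop. 3.1.4; §3.1.3 Remark 3.1.10 (2)]
[cite: Shimura1963AnalyticFamilies, §2] -/
theorem SiegelAdelicMarking.toFun_cover_apply_eq_of_periodRel (hg : 0 < g) (hδ : IsPolarizationType δ) (hN : 3 ≤ N)
    (hr : r ∈ principalLevelSubgroup δ 1) (hZ : Z ∈ siegelUpperHalfSpace g) (hZ' : Z' ∈ siegelUpperHalfSpace g)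
    (m : SiegelAdelicMarking ⟨jOfSiegel δ Z, SiegelComplexRecordSystem.jOfSiegel_mem_C0pm hδ.1 hZ⟩ r (B.fibre s).toAbelianVariety)
    (Λ : φ.SymplecticLift s Θ δ) (hΘl : B.IsLambdaOfAt s D lam Θ)
    (hΛ : ∀ ⦃M : ℕ⦄, N ∣ M → M ≠ 0 → ∀ (x : Fin g ⊕ Fin g → ZMod M) (v : Fin g ⊕ Fin g → ℚ),
      AdelicCongr ((r⁻¹ : gspFinAdelic δ) : GL (Fin g ⊕ Fin g) finAdeleQ) 1 v (fun i => ((x i).val : ℚ) / M) →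
        ((Λ.lift M (Multiplicative.ofAdd x)) : (B.fibre s).toAbelianVariety.Points ℂ) = m.r v)
    (m' : SiegelAdelicMarking ⟨jOfSiegel δ Z', SiegelComplexRecordSystem.jOfSiegel_mem_C0pm hδ.1 hZ'⟩ r (B.fibre s).toAbelianVariety)
    (Λ' : φ.SymplecticLift s Θ' δ) (hΘl' : B.IsLambdaOfAt s D lam Θ')
    (hΛ' : ∀ ⦃M : ℕ⦄, N ∣ M → M ≠ 0 → ∀ (x : Fin g ⊕ Fin g → ZMod M) (v : Fin g ⊕ Fin g → ℚ),
      AdelicCongr ((r⁻¹ : gspFinAdelic δ) : GL (Fin g ⊕ Fin g) finAdeleQ) 1 v (fun i => ((x i).val : ℚ) / M) →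
        ((Λ'.lift M (Multiplicative.ofAdd x)) : (B.fibre s).toAbelianVariety.Points ℂ) = m'.r v)
    (hγ : m.γ = 1) (hγ' : m'.γ = 1)
    (A : Matrix (Fin g ⊕ Fin g) (Fin g ⊕ Fin g) ℤ) {M₀ : GL (Fin g ⊕ Fin g) ℤ} (hM₀ : M₀ ∈ siegelLevelGroup δ N)
    (hM₀A : (M₀ : Matrix (Fin g ⊕ Fin g) (Fin g ⊕ Fin g) ℤ) * A = A * M₀)
    (L : (Fin g → ℂ) ≃ₗ[ℂ] (Fin g → ℂ)) (hL : ∀ w : Fin g ⊕ Fin g → ℝ, L (siegelPeriodMap δ Z w) = siegelPeriodMap δ Z' (intAct M₀ w))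
    (C C' : (Fin g → ℂ) → (Fin g → ℂ)) (hC : ∀ x : Fin g ⊕ Fin g → ℝ, C (m.Ψ x) = m.Ψ ((A.map (Int.cast : ℤ → ℝ)) *ᵥ x))
    (hC' : ∀ x : Fin g ⊕ Fin g → ℝ, C' (m'.Ψ x) = m'.Ψ ((A.map (Int.cast : ℤ → ℝ)) *ᵥ x))
    {z z' : Fin g → ℂ} (h : m.toFun (cover m.Ψ z) = m'.toFun (cover m'.Ψ z')) :
    m.toFun (cover m.Ψ (C z)) = m'.toFun (cover m'.Ψ (C' z')) := by
  -- the subgroup `Γ_δ(N) ∩ C(A)` of `Sp_δ(ℤ)`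
  obtain ⟨ΓA, hΓA⟩ := exists_subgroup_comm A
  have hΓ : siegelLevelGroup δ N ⊓ ΓA ≤ symplecticLatticeGroup δ := fun M hM => hM.1.1
  -- ★ Prop. 3.1.4: the period relation is a mover of that subgroup
  obtain ⟨M, hM, hZZ'⟩ := (SiegelModuli.rel_iff_exists_smul hδ.1 hΓ hZ hZ').1 ⟨M₀, ⟨hM₀, (hΓA M₀).2 hM₀A⟩, L, hL⟩
  exact SiegelAdelicMarking.toFun_cover_apply_eq_of_toFun_cover_eq hg hδ hN hr hZ hZ' m Λ hΘl hΛ m' Λ' hΘl' hΛ' M hM.1 hZZ' hγ hγ' A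
    ((hΓA _).1 hM.2) C C' hC hC' h

end Literature.AlgebraicGeometry.ModuliOfAbelianVarieties

end
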